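import Mathlib

/-!
# Reparametrisation of a continuous path of bounded variation by its total variation

Support file for item `RussoDrift` (stmt-CriticalPhenomena-10271) of route `CardySelfRefinement`
(sub-problem `CriticalPhenomena/CardyFormulaZ2`).  The route's RSW path `γ` is only continuous with
coordinates of bounded variation; the forced-tangency argument (Stieltjes integral of the Russo
gradient against `dγ`) is run in Lean after reparametrising `γ` by its total variation, which makes
it Lipschitz, so that Mathlib's fundamental theorem of calculus for absolutely continuous functions
and the one-dimensional Lebesgue differentiation theorem apply.

* `continuous_variationOnFromTo` — the signed total variation function
  `x ↦ variationOnFromTo f univ a x` of a continuous real function of bounded variation is continuous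
  (Mathlib has the right-continuity half, `BoundedVariationOn.continuousWithinAt_variationOnFromTo_Ici`;
  the left half is `BoundedVariationOn.tendsto_eVariationOn_Icc_zero_left`).
* `exists_lipschitz_reparam` — for a continuous `γ : ℝ → ℝ × ℝ` with both coordinates of bounded
  variation there are `L ≥ 0` and a MONOTONE `σ : ℝ → ℝ` with `γ (σ 0) = γ 0`, `γ (σ L) = γ 1` and both
  coordinates of `γ ∘ σ` `1`-Lipschitz (`σ` is a section of the total variation function
  `V = Var(γ₁) + Var(γ₂)` on `[0,1]`, clamped outside `[0, L]`, `L = V 1`; any section is monotone, and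
  `|γᵢ(x) − γᵢ(y)| ≤ |V x − V y|`).

Pure real analysis (Mathlib only); folklore.
-/

noncomputable section

open Set Filter Topology

namespace Summit.CriticalPhenomena.CardyFormulaZ2.Theorems.RussoDrift

/-- The total variation function `x ↦ variationOnFromTo f univ a x` of a continuous real function of
bounded variation on `ℝ` is continuous (folklore; right-continuity is Mathlib's
`BoundedVariationOn.continuousWithinAt_variationOnFromTo_Ici`, left-continuity follows from
`BoundedVariationOn.tendsto_eVariationOn_Icc_zero_left`). -/
theorem continuous_variationOnFromTo {f : ℝ → ℝ} (hf : BoundedVariationOn f univ)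
    (hc : Continuous f) (a : ℝ) : Continuous (variationOnFromTo f univ a) := by
  rw [continuous_iff_continuousAt]
  intro x
  rw [continuousAt_iff_continuous_left_right]
  refine ⟨?_, hf.continuousWithinAt_variationOnFromTo_Ici hc.continuousWithinAt⟩
  have hadd : ∀ y, variationOnFromTo f univ a y =
      variationOnFromTo f univ a x + variationOnFromTo f univ x y := fun y =>
    (variationOnFromTo.add hf.locallyBoundedVariationOn (mem_univ _) (mem_univ _) (mem_univ _)).symm
  have h0 : Tendsto (fun y => (eVariationOn f (univ ∩ Icc y x)).toReal) (𝓝[Iic x] x) (𝓝 0) := by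
    have h1 := hf.tendsto_eVariationOn_Icc_zero_left (x := x)
      (hc.continuousWithinAt (s := univ ∩ Iic x))
    rw [nhdsWithin_univ] at h1
    have h2 : Tendsto (fun y => eVariationOn f (univ ∩ Icc y x)) (𝓝[Iic x] x) (𝓝 0) :=
      h1.mono_left nhdsWithin_le_nhds
    have h3 := (ENNReal.tendsto_toReal ENNReal.zero_ne_top).comp h2
    rw [ENNReal.toReal_zero] at h3
    exact h3
  have h3 : Tendsto (fun y => variationOnFromTo f univ a x + -(eVariationOn f (univ ∩ Icc y x)).toReal)
      (𝓝[Iic x] x) (𝓝 (variationOnFromTo f univ a x)) := by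
    simpa using tendsto_const_nhds.add h0.neg
  refine h3.congr' ?_
  filter_upwards [self_mem_nhdsWithin] with y hy
  rw [hadd y, variationOnFromTo.eq_of_ge f univ hy]

/-- **Lipschitz reparametrisation of a continuous `BV` path.**  For a continuous `γ : ℝ → ℝ × ℝ` whose
two coordinates have bounded variation there are `L ≥ 0` and a monotone `σ : ℝ → ℝ` such that
`γ (σ 0) = γ 0`, `γ (σ L) = γ 1`, and both coordinates of `γ ∘ σ` are `1`-Lipschitz.  (`σ` is a
section of the clamped total variation `V = Var γ₁ + Var γ₂` from `0`; folklore "parametrisation by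
arc length", in the form needed by `RussoDrift`: only the range of the path, its endpoints and its
orientation matter there.) -/
theorem exists_lipschitz_reparam (γ : ℝ → ℝ × ℝ) (hγ : Continuous γ)
    (h₁ : BoundedVariationOn (fun t => (γ t).1) univ)
    (h₂ : BoundedVariationOn (fun t => (γ t).2) univ) :
    ∃ L : ℝ, 0 ≤ L ∧ ∃ σ : ℝ → ℝ, Monotone σ ∧ γ (σ 0) = γ 0 ∧ γ (σ L) = γ 1 ∧
      LipschitzWith 1 (fun t => (γ (σ t)).1) ∧ LipschitzWith 1 (fun t => (γ (σ t)).2) := by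
  classical
  set f₁ : ℝ → ℝ := fun t => (γ t).1 with hf₁
  set f₂ : ℝ → ℝ := fun t => (γ t).2 with hf₂
  have hc₁ : Continuous f₁ := continuous_fst.comp hγ
  have hc₂ : Continuous f₂ := continuous_snd.comp hγ
  set V : ℝ → ℝ := fun x => variationOnFromTo f₁ univ 0 x + variationOnFromTo f₂ univ 0 x with hV
  have hVc : Continuous V :=
    (continuous_variationOnFromTo h₁ hc₁ 0).add (continuous_variationOnFromTo h₂ hc₂ 0)
  have m1 := variationOnFromTo.monotoneOn h₁.locallyBoundedVariationOn (mem_univ (0 : ℝ))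
  have m2 := variationOnFromTo.monotoneOn h₂.locallyBoundedVariationOn (mem_univ (0 : ℝ))
  have hVm : Monotone V := fun x y hxy =>
    add_le_add (m1 (mem_univ x) (mem_univ y) hxy) (m2 (mem_univ x) (mem_univ y) hxy)
  have hV0 : V 0 = 0 := by simp [hV, variationOnFromTo.self]
  -- the coordinates move by at most the increment of `V`
  have keyle : ∀ x y, x ≤ y → |f₁ y - f₁ x| ≤ V y - V x ∧ |f₂ y - f₂ x| ≤ V y - V x := by
    intro x y hxy
    have a1 := variationOnFromTo.abs_sub_le_sub_of_le h₁.locallyBoundedVariationOn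
      (mem_univ 0) (mem_univ x) (mem_univ y) hxy
    have a2 := variationOnFromTo.abs_sub_le_sub_of_le h₂.locallyBoundedVariationOn
      (mem_univ 0) (mem_univ x) (mem_univ y) hxy
    have n1 := m1 (mem_univ x) (mem_univ y) hxy
    have n2 := m2 (mem_univ x) (mem_univ y) hxy
    simp only [hV]
    constructor <;> linarith
  have key : ∀ x y, |f₁ y - f₁ x| ≤ |V y - V x| ∧ |f₂ y - f₂ x| ≤ |V y - V x| := by
    intro x y
    rcases le_total x y with hxy | hxy
    · rw [abs_of_nonneg (sub_nonneg.2 (hVm hxy))]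
      exact keyle x y hxy
    · rw [abs_sub_comm (f₁ y), abs_sub_comm (f₂ y), abs_sub_comm (V y),
        abs_of_nonneg (sub_nonneg.2 (hVm hxy))]
      exact keyle y x hxy
  -- `V` maps `[0,1]` onto `[0, L]`
  set L := V 1 with hL
  have hL0 : 0 ≤ L := by rw [hL, ← hV0]; exact hVm zero_le_one
  have hsurj : ∀ y ∈ Icc 0 L, ∃ x ∈ Icc (0 : ℝ) 1, V x = y := by
    intro y hy
    have h := intermediate_value_Icc zero_le_one hVc.continuousOn
    rw [hV0] at h
    obtain ⟨x, hx, hxy⟩ := h hy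
    exact ⟨x, hx, hxy⟩
  -- a section of `V`, composed with the clamp to `[0, L]`
  let τ : ℝ → ℝ := fun y => if h : y ∈ Icc 0 L then (hsurj y h).choose else 0
  have hτ : ∀ y (h : y ∈ Icc 0 L), V (τ y) = y := by
    intro y h
    simp only [τ, dif_pos h]
    exact (hsurj y h).choose_spec.2
  let c : ℝ → ℝ := fun t => max 0 (min L t)
  have hc : ∀ t, c t ∈ Icc 0 L := fun t => ⟨le_max_left _ _, max_le hL0 (min_le_left _ _)⟩
  have hcl : ∀ t t', |c t - c t'| ≤ |t - t'| := by
    intro t t'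
    calc |c t - c t'| ≤ max |(0 : ℝ) - 0| |min L t - min L t'| := abs_max_sub_max_le_max _ _ _ _
      _ = |min L t - min L t'| := by simp
      _ ≤ max |L - L| |t - t'| := abs_min_sub_min_le_max _ _ _ _
      _ = |t - t'| := by simp
  have hcm : Monotone c := fun t t' h => max_le_max le_rfl (min_le_min le_rfl h)
  let σ : ℝ → ℝ := fun t => τ (c t)
  have hVσ : ∀ t, V (σ t) = c t := fun t => hτ (c t) (hc t)
  have hσm : Monotone σ := by
    intro t t' htt'
    rcases (hcm htt').lt_or_eq with hlt | heq
    · by_contra hle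
      have h := hVm (not_le.1 hle).le
      rw [hVσ, hVσ] at h
      exact absurd h (not_le.2 hlt)
    · exact (congrArg τ heq).le
  have hlip : ∀ g : ℝ → ℝ, (∀ x y, |g y - g x| ≤ |V y - V x|) → LipschitzWith 1 fun t => g (σ t) := by
    intro g hg
    refine LipschitzWith.of_dist_le_mul fun t t' => ?_
    rw [Real.dist_eq, Real.dist_eq, NNReal.coe_one, one_mul]
    calc |g (σ t) - g (σ t')| ≤ |V (σ t) - V (σ t')| := hg (σ t') (σ t)
      _ = |c t - c t'| := by rw [hVσ, hVσ]
      _ ≤ |t - t'| := hcl t t'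
  have hend : ∀ t s, V (σ t) = V s → γ (σ t) = γ s := by
    intro t s hts
    have e1 := (key s (σ t)).1
    have e2 := (key s (σ t)).2
    rw [hts, sub_self, abs_zero, abs_nonpos_iff, sub_eq_zero] at e1 e2
    exact Prod.ext e1 e2
  refine ⟨L, hL0, σ, hσm, hend 0 0 ?_, hend L 1 ?_, hlip f₁ fun x y => (key x y).1,
    hlip f₂ fun x y => (key x y).2⟩
  · rw [hVσ, hV0]
    exact max_eq_left (min_le_right _ _)
  · rw [hVσ, ← hL]
    simp [c, hL0]

end Summit.CriticalPhenomena.CardyFormulaZ2.Theorems.RussoDrift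

end
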